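/-
Copyright (c) 2026. All rights reserved.
Released under Apache 2.0 license as described in the file LICENSE.
Authors: abc-iut cell, seat abc-iut-L4-t9 (gen 3, construction; gen 4, filing/split; block W2-B2, model of
[AbsTopIII] Cor 3.7).
-/
import Literature.AnabelianGeometry.AbsoluteAnabelian.AbsTopIII.BiAnabelianModelSignTwist
import HarnessLib

/-!
# [AbsTopIII] Cor 3.7 (v) needs the "strictly Belyi type" restriction, part 2: the bare model category
# of MLF-Galois `TF`-pairs on `ℚ̄_p` is NOT id-rigid

S. Mochizuki, *Topics in absolute anabelian geometry III* [MochizukiAbsTopIII2015] (kurims manuscript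
`paper:url-5493eb38cbb7`), §0 p. 27 (rigid functors, id-rigid categories); Cor 3.7 (v) p. 88 ("`𝒟*` is
totally `□`-rigid") for `𝒳 = 𝒞^{MLF-sB}_{TF}`, pairs of strictly Belyi type (Def 3.1 (ii) p. 67).

Continuation of `BiAnabelianModelSignTwist.lean` (the twisting automorphisms `η_B = (ψ_B, id)`).  Here:
`η_B` is NATURAL in `B` (Galois-isomorphisms map kernels onto kernels and conjugate the augmentations
inside `Gal(ℚ̄_p/ℚ_p)` — `MLFGaloisModelRigidity` — where the quadratic sign `σ ↦ σ(√p)/√p` is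
conjugation-invariant), so `η : 𝟭_𝒳 ⥲ 𝟭_𝒳` (`etaNatIso`); and `η ≠ id` at the witness object
`(G_{ℚ_p} × ℤ/2 ↠ G_{ℚ_p} ↷ ℚ̄_p)` (`twoKernelObj`).  Hence

* `TFModel.not_isIdRigid : ¬ IsIdRigid (TFModel p)` —

the input `hX : IsIdRigid X` of abc-iut-L4-t12's `BiAnabelianSetting.cor_3_7_v_of_lift` is FALSE for the
bare model (Def 3.1 (i)–(iii) alone) and is supplied exactly by the printed `sB` restriction (slimness;
`TFModel.isIdRigid_slim`, `MLFGaloisModelIdRigid.lean`).  HONEST FRAMING: a statement about OUR model;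
it contradicts nothing in print and bears on nothing in [IUTchIII].
-/

set_option autoImplicit false

noncomputable section

namespace Literature.AnabelianGeometry.AbsoluteAnabelian.AbsTopIII

open CategoryTheory

namespace TFModel

variable {p : ℕ} [hp : Fact p.Prime]

section Naturality

variable {B B' : TFModel p}

/-- A Galois-isomorphism respects kernels: `ε'(φ_Π g) = 1 ↔ ε(g) = 1`.
[cite: MochizukiAbsTopIII2015, Definition 3.1 (ii) p.67] -/
theorem aug_map_eq_one_iff (f : B ⟶ B') (g : B.pair.Pi) :
    B'.D.aug ((f : Hom B B').hom.homPi g) = 1 ↔ B.D.aug g = 1 := by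
  rw [B'.aug_eq_one_iff, B.aug_eq_one_iff, ← Subgroup.mem_comap, (f : Hom B B').hom.comap_ker]

/-- Galois-isomorphisms map order-two kernels to order-two kernels.
[cite: MochizukiAbsTopIII2015, Definition 3.1 (ii) p.67] -/
theorem IsKerTwo.map (f : B ⟶ B') {z : B.pair.Pi} (hz : B.IsKerTwo z) :
    B'.IsKerTwo ((f : Hom B B').hom.homPi z) := by
  refine ⟨fun h => hz.1 ((f : Hom B B').bijective.1 (by rw [h, map_one])),
    (aug_map_eq_one_iff f z).2 hz.2.1, fun g' hg' => ?_⟩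
  obtain ⟨g, rfl⟩ := (f : Hom B B').bijective.2 g'
  rcases hz.2.2 g ((aug_map_eq_one_iff f g).1 hg') with rfl | rfl
  · exact Or.inl (map_one _)
  · exact Or.inr rfl

/-- ... and conversely (pull back along the bijection `φ_Π`).
[cite: MochizukiAbsTopIII2015, Definition 3.1 (ii) p.67] -/
theorem IsKerTwo.comap (f : B ⟶ B') {z' : B'.pair.Pi} (hz' : B'.IsKerTwo z') : ∃ z, B.IsKerTwo z := by
  obtain ⟨z, rfl⟩ := (f : Hom B B').bijective.2 z'
  refine ⟨z, fun h => hz'.1 (by rw [h, map_one]), (aug_map_eq_one_iff f z).1 hz'.2.1, fun g hg => ?_⟩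
  rcases hz'.2.2 _ ((aug_map_eq_one_iff f g).2 hg) with h1 | h1
  · exact Or.inl ((f : Hom B B').bijective.1 (h1.trans (map_one _).symm))
  · exact Or.inr ((f : Hom B B').bijective.1 h1)

/-- Galois-isomorphisms preserve the canonical kernel element: `φ_Π(z_B) = z_{B'}`.
[cite: MochizukiAbsTopIII2015, Definition 3.1 (ii) p.67] -/
theorem map_kerElt (f : B ⟶ B') : (f : Hom B B').hom.homPi B.kerElt = B'.kerElt := by
  by_cases h : ∃ z, B.IsKerTwo z
  · obtain ⟨z, hz⟩ := h
    rw [kerElt_eq hz, kerElt_eq (hz.map f)]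
  · have h' : ¬ ∃ z', B'.IsKerTwo z' := fun ⟨z', hz'⟩ => h (hz'.comap f)
    rw [kerElt_eq_one h, kerElt_eq_one h', map_one]

/-- Galois-isomorphisms preserve the quadratic sign of the augmentation:
`ε'(φ_Π g)(√p) = √p ↔ ε(g)(√p) = √p` (conjugation invariance, `TFModel.Hom.augQ_homPi`).
[cite: MochizukiAbsTopIII2015, Definition 3.1 (ii) p.67] -/
theorem fixes_map_iff (f : B ⟶ B') (g : B.pair.Pi) :
    B'.augQ ((f : Hom B B').hom.homPi g) (sqrtPrime p) = sqrtPrime p ↔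
      B.augQ g (sqrtPrime p) = sqrtPrime p := by
  rw [(f : Hom B B').augQ_homPi g]
  exact fixes_sqrtPrime_conj p (f : Hom B B').galois (B.augQ g)

/-- Galois-isomorphisms intertwine the twists: `φ_Π(t_B(g)) = t_{B'}(φ_Π g)`.
[cite: MochizukiAbsTopIII2015, Definition 3.1 (ii) p.67] -/
theorem map_twist (f : B ⟶ B') (g : B.pair.Pi) :
    (f : Hom B B').hom.homPi (B.twist g) = B'.twist ((f : Hom B B').hom.homPi g) := by
  by_cases hg : B.augQ g (sqrtPrime p) = sqrtPrime p
  · rw [B.twist_of_fixes hg, B'.twist_of_fixes ((fixes_map_iff f g).2 hg), map_one]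
  · rw [B.twist_of_not_fixes hg, B'.twist_of_not_fixes (fun H => hg ((fixes_map_iff f g).1 H)),
      map_kerElt]

/-- **Naturality of `η`**: `φ ∘ η_B = η_{B'} ∘ φ` for every Galois-isomorphism `φ : B → B'`.
[cite: MochizukiAbsTopIII2015, Section 0 p.27] -/
theorem eta_naturality (f : B ⟶ B') : f ≫ B'.eta = B.eta ≫ f := by
  refine Hom.ext (GaloisFieldPair.Hom.ext ?_ ?_)
  · ext g
    change B'.psi ((f : Hom B B').hom.homPi g) = (f : Hom B B').hom.homPi (B.psi g)
    rw [psi_apply, psi_apply, map_mul, map_twist]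
  · rfl

end Naturality

/-! ## The natural automorphism `η` of `𝟭_𝒳` and the witness object `(G_{ℚ_p} × ℤ/2 ↠ G_{ℚ_p} ↷ ℚ̄_p)` -/

/-- `η_B` as an isomorphism (its own inverse). [cite: MochizukiAbsTopIII2015, Section 0 p.27] -/
def etaIso (B : TFModel p) : B ≅ B where
  hom := B.eta
  inv := B.eta
  hom_inv_id := Hom.ext (GaloisFieldPair.Hom.ext (MonoidHom.ext fun g => B.psi_psi g) rfl)
  inv_hom_id := Hom.ext (GaloisFieldPair.Hom.ext (MonoidHom.ext fun g => B.psi_psi g) rfl)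

variable (p)

/-- **The natural automorphism `η : 𝟭_𝒳 ⥲ 𝟭_𝒳`** with components `η_B = (ψ_B, id)`.
[cite: MochizukiAbsTopIII2015, Section 0 p.27] -/
def etaNatIso : 𝟭 (TFModel p) ≅ 𝟭 (TFModel p) :=
  NatIso.ofComponents (fun B => etaIso B) (fun f => eta_naturality f)

/-- An automorphism of `ℚ̄_p/ℚ_p` as an automorphism over the bottom intermediate field `⊥ = ℚ_p`.
[cite: MochizukiAbsTopIII2015, Definition 3.1 (i) p.66] -/
def liftBot (σ : PadicAlgCl p ≃ₐ[ℚ_[p]] PadicAlgCl p) :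
    PadicAlgCl p ≃ₐ[(⊥ : IntermediateField ℚ_[p] (PadicAlgCl p))] PadicAlgCl p :=
  { σ.toRingEquiv with
    commutes' := fun r => by
      obtain ⟨q, hq⟩ := IntermediateField.mem_bot.mp r.2
      change σ (r : PadicAlgCl p) = r
      rw [← hq]
      exact σ.commutes q }

/-- `liftBot σ` is `σ` as a function. [cite: MochizukiAbsTopIII2015, Definition 3.1 (i) p.66] -/
@[simp] theorem liftBot_apply (σ : PadicAlgCl p ≃ₐ[ℚ_[p]] PadicAlgCl p) (x : PadicAlgCl p) :
    liftBot p σ x = σ x := rfl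

/-- **The witness object** `(G_{ℚ_p} × ℤ/2 ↠ G_{ℚ_p} ↷ ℚ̄_p)`: model data of Def 3.1 (i) over `k = ℚ_p`
with `Π_k := G_{ℚ_p} × ℤ/2` and `ε_k` the first projection (continuous, surjective) — an MLF-Galois
`TF`-pair which is NOT of strictly Belyi type. [cite: MochizukiAbsTopIII2015, Definition 3.1 (i) p.66] -/
def twoKernelObj : TFModel p where
  k := ⊥
  D := { Pi := (PadicAlgCl p ≃ₐ[(⊥ : IntermediateField ℚ_[p] (PadicAlgCl p))] PadicAlgCl p) ×
           Multiplicative (ZMod 2)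
         aug := MonoidHom.fst _ _
         continuous_aug := continuous_fst
         aug_surjective := fun σ => ⟨(σ, 1), rfl⟩ }

/-- Every element of `ℤ/2` (written multiplicatively) is `1` or the generator.
[cite: MochizukiAbsTopIII2015, Section 0 p.27] -/
theorem multiplicative_zmod_two_cases (e : Multiplicative (ZMod 2)) :
    e = 1 ∨ e = Multiplicative.ofAdd 1 := by
  have h : ∀ a : ZMod 2, a = 0 ∨ a = 1 := by decide
  rcases h (Multiplicative.toAdd e) with h0 | h0
  · exact Or.inl (by rw [← ofAdd_toAdd e, h0]; rfl)
  · exact Or.inr (by rw [← ofAdd_toAdd e, h0])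

/-- The kernel of the witness object has exactly two elements, `z = (1, 1̄)`.
[cite: MochizukiAbsTopIII2015, Definition 3.1 (i) p.66] -/
theorem twoKernelObj_isKerTwo :
    (twoKernelObj p).IsKerTwo ((1, Multiplicative.ofAdd 1) : (twoKernelObj p).D.Pi) := by
  refine ⟨fun h => ?_, rfl, fun g hg => ?_⟩
  · have h2 := congrArg Prod.snd h
    change Multiplicative.ofAdd (1 : ZMod 2) = Multiplicative.ofAdd 0 at h2
    exact absurd (Multiplicative.ofAdd.injective h2) (by decide)
  · have hg1 : g.1 = 1 := hg
    rcases multiplicative_zmod_two_cases g.2 with h2 | h2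
    · exact Or.inl (Prod.ext hg1 h2)
    · exact Or.inr (Prod.ext hg1 h2)

/-- **The model category `𝒳 = TFModel p` is NOT id-rigid**: the natural automorphism `η` of `𝟭_𝒳` is
non-trivial at the witness object (for `σ₀ ∈ G_{ℚ_p}` negating `√p`, `ψ(σ₀, 0̄) = (σ₀, 1̄) ≠ (σ₀, 0̄)`).
Hence abc-iut-L4-t12's hypothesis `IsIdRigid X` of `cor_3_7_v_of_lift` is NOT available from Def 3.1
(i)–(iii) alone: Cor 3.7 (v) consumes the strictly-Belyi-type (slimness) restriction `𝒞^{MLF-sB}`.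
[cite: MochizukiAbsTopIII2015, Cor 3.7 (v) p.88] -/
theorem not_isIdRigid : ¬ IsIdRigid (TFModel p) := by
  intro hrig
  obtain ⟨σ₀, hσ₀⟩ := exists_algEquiv_neg_sqrtPrime p
  have hne : ¬ σ₀ (sqrtPrime p) = sqrtPrime p := by rw [hσ₀]; exact neg_sqrtPrime_ne p
  set B := twoKernelObj p with hB
  set g₀ : B.pair.Pi := ((liftBot p σ₀, 1) : B.D.Pi) with hg₀
  -- `η = id` by id-rigidity, so `ψ_B g₀ = g₀`
  have h1 := hrig (etaNatIso p)
  have h2 : (B.eta : Hom B B).hom.homPi g₀ = g₀ := by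
    have h3 := congrArg (fun α : 𝟭 (TFModel p) ≅ 𝟭 (TFModel p) => ((α.hom.app B : Hom B B)).hom.homPi g₀) h1
    exact h3
  rw [eta_homPi_apply, psi_apply] at h2
  -- but `t_B(g₀) = z_B = (1, 1̄) ≠ 1`
  have hfix : ¬ B.augQ g₀ (sqrtPrime p) = sqrtPrime p := hne
  rw [B.twist_of_not_fixes hfix, kerElt_eq (twoKernelObj_isKerTwo p)] at h2
  have h4 := congrArg Prod.snd h2
  change (1 : Multiplicative (ZMod 2)) * Multiplicative.ofAdd 1 = 1 at h4
  rw [one_mul] at h4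
  exact absurd (Multiplicative.ofAdd.injective (h4.trans ofAdd_zero.symm)) (by decide)

end TFModel

end Literature.AnabelianGeometry.AbsoluteAnabelian.AbsTopIII

end

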